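import Summits.BirchSwinnertonDyer.BirchSwinnertonDyer.Theses.SelmerRank
import Literature.NumberTheory.EllipticCurves.KuriharaNumber
import Literature.NumberTheory.EllipticCurves.KatoKolyvaginPrimes
import Literature.NumberTheory.EllipticCurves.CuspFormLFunction
import Literature.NumberTheory.EllipticCurves.HeegnerPoints
import Literature.NumberTheory.EllipticCurves.RootNumber

/-! Scratch (crux-strategist, stmt-BirchSwinnertonDyer-0131): first lemmas of the crux ideas, typed
over existing declarations. Not a line; see `line-kurihara-order.lean` for the registered skeleton. -/

noncomputable section

set_option linter.dupNamespace false

open scoped MatrixGroups ModularForm Classical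
open CongruenceSubgroup Literature.NumberTheory.EllipticCurves
  Literature.NumberTheory.EllipticCurves.ModularForms

namespace Summit.BirchSwinnertonDyer.BirchSwinnertonDyer.Cruxes.SelmerRankLB.Scratch

/-- FIRST LEMMA of idea `level-raising-transport` (lens: transfer). The slice `(r_an, ν) = (3,1)` of
stub V2a with the analytic hypothesis `ord_{s=1} L(E,s) ≥ 3` replaced by its Gross–Zagier AVATAR:
`w(E) = −1`, and for some Heegner field `K` with `L(E^{(d_K)}, 1) ≠ 0` (twist analytic rank `0`)
SOME (equivalently every: they differ by sign and torsion) Heegner point `P_K ∈ E(K)` of level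
`N_E` is torsion (⟺ `L'(E/K,1) = 0` ⟺ `r_an(E) ≥ 3`, Gross–Zagier I.6.3; `∃` rather than `∀` so that the
hypothesis cannot hold vacuously). Conclusion: every first-layer Kurihara number `δ̃_ℓ^{(k)}` (`ℓ ∈ 𝒫_k`) of the
newform of `E` vanishes. TRUE (via Selmer groups: GZ ⇒ r_an ≥ 3 ⇒ [V2a: Kim 1.9 + Cor 1.12 +
corank-1 p-converse]); the idea proposes a Selmer-free proof by level raising at `ℓ` + a tame
exceptional-zero formula for the level-raised form + a Jochnowitz-type congruence. [conjecture] -/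
theorem firstLemma_heegnerTorsion_kills_delta_prime :
    ∀ (W : WeierstrassCurve ℚ) [W.IsElliptic] [W.IsGloballyMinimal] (p : ℕ) [Fact p.Prime],
      5 ≤ p → W.HasGoodReductionAtPrime p → ¬ (p : ℤ) ∣ W.frobeniusTrace p →
      W.HasSurjectiveModNGaloisRep p →
      ∀ (_ : NeZero (W.conductorNorm ℤ)) (f : CuspForm (Gamma0 (W.conductorNorm ℤ)) 2),
        IsNewformOf W f → W.rootNumber = -1 →
        (∃ (K : Type) (_ : Field K) (_ : NumberField K), IsImaginaryQuadratic K ∧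
          SatisfiesHeegnerHypothesis (W.conductorNorm ℤ) K ∧
          (W.quadraticTwist (NumberField.discr K : ℚ)).analyticRank = 0 ∧
          ∃ P : (W.baseChange K).toAffine.Point,
            IsHeegnerPoint (W.conductorNorm ℤ) W K P ∧ IsOfFinAddOrder P) →
        ∀ (k ℓ : ℕ) [NeZero ℓ], 1 ≤ k → Kato.IsKolyvaginPrime W p k ℓ →
          ∀ ψ : (q : ℕ) → (ZMod q)ˣ →* Multiplicative (ZMod (p ^ k)),
            Function.Surjective (ψ ℓ) → kuriharaNumber f (p ^ k) ℓ ψ = 0 := by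
  sorry

/-- FIRST LEMMA of idea `analytic-mazur-tate-depth` (lens: strengthen). The top-coefficient
bookkeeping S⁺ ⇒ (KV): for a finite product `G = Π_{i<ν} ℤ/p^k` and `θ ∈ ℤ/p^k[G]`, if `θ` lies
in the `(ν+1)`-st power of the augmentation ideal then its top mixed coefficient
`Σ_g c_g · Π_i log_i(g)` vanishes (difference-operator / degree argument; Kim §3.5, Kurihara 2012).
Stated here in the smallest case `ν = 1`: for `G = Multiplicative (ZMod (p^k))` and
`θ ∈ I_G^2`, `Σ_m c_m · m = 0` in `ℤ/p^k`. [folklore] -/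
theorem firstLemma_topCoefficient_vanishes_of_mem_augIdeal_sq (p k : ℕ)
    (θ : MonoidAlgebra (ZMod (p ^ k)) (Multiplicative (ZMod (p ^ k))))
    (hθ : θ ∈ (RingHom.ker (MonoidAlgebra.lift (ZMod (p ^ k)) (ZMod (p ^ k))
      (Multiplicative (ZMod (p ^ k))) 1)) ^ 2) :
    (θ.coeff.sum fun g c => c * Multiplicative.toAdd g) = 0 := by
  sorry

end Summit.BirchSwinnertonDyer.BirchSwinnertonDyer.Cruxes.SelmerRankLB.Scratch

end
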